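import Literature.Analysis.FluidPDE.HydrodynamicImpulseBalanceEnergy
import HarnessLib

/-!
# Hydrodynamic impulse, V: the FULL impulse balance `∫ x × ω(t) − ∫ x × ω(s) = 2 ∫ₛᵗ ∫ f` from the ENERGY alone
# (Saffman (3.2.9) for every classical finite-energy forced flow on `ℝ³`, every direction)

Sequel of `HydrodynamicImpulseBalanceEnergy.lean` (the axial component, test field `curl (χ_R J)` with
`Jx = (−x₁, x₀, 0) = e₃ × x`). Here the rotation generator is replaced by `J_a x = a × x` for an ARBITRARY vector
`a` (`curl J_a = 2a`; `⟪curl v, a × x⟫ = ⟪a, x × curl v⟫`), which gives the `a`-component of Saffman's law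
`dI/dt = ∫ F dV`, `I = ½∫ x × ω`, with NO hypothesis on the vorticity inside the time interval — only the classical
equations on `[0, T] × ℝ³`, a uniform energy level `∫ ‖u(τ)‖² ≤ E` and an integrable majorant of the force slices:

* `IsClassicalNSSolutionOn.tendsto_integral_cutoff_inner_cross_vorticity_sub` — the truncated `a`-impulses satisfy
  `∫ χ_n ⟪a, x × ω(t)⟫ − ∫ χ_n ⟪a, x × ω(s)⟫ → 2 ∫ₛᵗ ∫ ⟪a, f⟫` (`χ_n = cutoff (n+1)`);
* `IsClassicalNSSolutionOn.integral_inner_cross_vorticity_sub_eq_of_energy` — exact `a`-component law when the two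
  endpoint densities are integrable;
* **`IsClassicalNSSolutionOn.integral_cross_vorticity_sub_eq_of_energy`** — THE VECTOR LAW: if `x × ω(s)` and
  `x × ω(t)` are integrable, `∫ x × ω(t) dx − ∫ x × ω(s) dx = 2 ∫ₛᵗ ∫ f dx dτ`. This removes the first-moment
  hypothesis on `x × ∂ₜω` of `HydrodynamicImpulseBalance.lean`'s `integral_cross_vorticity_sub_eq` (which needed
  `|x|(|ω| + |∇ω| + |Δω|) ∈ L¹` uniformly in time): finite energy is enough.

Method (as in part IV, after the tree's `GallaySverak2015.ImpulseConservation_holds`): `∫ χ_R ⟪a, x × ω⟫ = ∫⟪u, ψ_{R,a}⟫`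
with the compactly supported divergence-free `ψ_{R,a} = curl (χ_R J_a)`; the momentum equation tested against `ψ_{R,a}`
(`IsClassicalNSSolutionOn.integral_inner_sub_eq_pressure`) leaves `O((t−s)/√R)` (slice estimate: `‖Dψ_{R,a}‖ ≤ B₁/R`,
`‖Δψ_{R,a}‖ ≤ B₂/R²`, only the energy enters) plus `∫ₛᵗ∫⟪f, ψ_{R,a}⟫ → 2∫ₛᵗ∫⟪a, f⟫` (`ψ_{R,a} ≡ 2a` on the ball of radius
`R`, `‖ψ_{R,a}‖ ≤ B₀`; dominated convergence).

References: P. G. Saffman, *Vortex Dynamics* (1992) §3.2 (3.2.8), (3.2.9) [cite: Saffman1992, §3.2 (3.2.8)–(3.2.9)];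
Th. Gallay, V. Šverák, Confluentes Math. 7 (2015), Lemma 6.4 (arXiv p. 19) [cite: GallaySverak2016, Lemma 6.4];
J. Leray, Acta Math. 63 (1934) §III (17) [cite: Leray1934, §III (17)].
-/

noncomputable section

open MeasureTheory Set Function Filter Topology InnerProductSpace Metric
open scoped RealInnerProductSpace ENNReal NNReal Laplacian ContDiff Interval

namespace Literature.Analysis.FluidPDE

variable (a : EuclideanSpace ℝ (Fin 3))

/-! ### §1 The test fields `ψ_{R,a} = curl (χ_R J_a)`, `J_a x = a × x` -/

section TestField

/-- The vector potential `χ_R J_a`, `J_a x = a × x`, is smooth. [folklore] -/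
private theorem contDiff_potential {n : ℕ∞} (R : ℝ) :
    ContDiff ℝ n (fun x : EuclideanSpace ℝ (Fin 3) => cutoff R x • crossCLM a x) :=
  (contDiff_cutoff R).smul (crossCLM a).contDiff

/-- The vector potential `χ_R J_a` has compact support (`R > 0`). [folklore] -/
private theorem hasCompactSupport_potential {R : ℝ} (hR : 0 < R) :
    HasCompactSupport (fun x : EuclideanSpace ℝ (Fin 3) => cutoff R x • crossCLM a x) :=
  (hasCompactSupport_cutoff hR).smul_right

/-- The vector potential `χ_R J_a` is supported in the closed ball of radius `2R`. [folklore] -/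
private theorem tsupport_potential_subset {R : ℝ} (hR : 0 < R) :
    tsupport (fun x : EuclideanSpace ℝ (Fin 3) => cutoff R x • crossCLM a x) ⊆ closedBall 0 (2 * R) :=
  (tsupport_smul_subset_left _ _).trans (tsupport_cutoff_subset hR)

/-- Scaling of the potential: `χ_R(x) (a × x) = R · (χ_1 J_a)(x / R)`. [folklore] -/
private theorem potential_eq_scale {R : ℝ} (hR : 0 < R) :
    (fun x : EuclideanSpace ℝ (Fin 3) => cutoff R x • crossCLM a x) =
      fun x => R • (fun y : EuclideanSpace ℝ (Fin 3) => cutoff 1 y • crossCLM a y) (R⁻¹ • x) := by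
  funext x
  have h1 : cutoff 1 (R⁻¹ • x) = cutoff R x := by simp [cutoff_apply]
  simp only [h1, map_smul, smul_smul]
  congr 1
  field_simp

/-- Scaling of the Jacobian: `D(χ_R J_a)(x) = D(χ_1 J_a)(x / R)`. [folklore] -/
private theorem fderiv_potential_eq {R : ℝ} (hR : 0 < R) (x : EuclideanSpace ℝ (Fin 3)) :
    fderiv ℝ (fun x : EuclideanSpace ℝ (Fin 3) => cutoff R x • crossCLM a x) x =
      fderiv ℝ (fun y : EuclideanSpace ℝ (Fin 3) => cutoff 1 y • crossCLM a y) (R⁻¹ • x) := by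
  rw [potential_eq_scale a hR]
  have hd : DifferentiableAt ℝ
      (fun x => (fun y : EuclideanSpace ℝ (Fin 3) => cutoff 1 y • crossCLM a y) (R⁻¹ • x)) x :=
    (((contDiff_potential a (n := 1) 1).differentiable one_ne_zero).comp
      (differentiable_id.const_smul R⁻¹)).differentiableAt
  rw [fderiv_fun_const_smul hd,
    fderiv_comp_smul (f := fun y : EuclideanSpace ℝ (Fin 3) => cutoff 1 y • crossCLM a y) R⁻¹, smul_smul,
    mul_inv_cancel₀ hR.ne', one_smul]

/-- **Scaling of the test field**: `curl (χ_R J_a)(x) = curl (χ_1 J_a)(x / R)`. [folklore] -/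
private theorem testField_eq_scale {R : ℝ} (hR : 0 < R) (x : EuclideanSpace ℝ (Fin 3)) :
    curl (fun x : EuclideanSpace ℝ (Fin 3) => cutoff R x • crossCLM a x) x =
      curl (fun y : EuclideanSpace ℝ (Fin 3) => cutoff 1 y • crossCLM a y) (R⁻¹ • x) := by
  rw [curl_eq_curlCLM, curl_eq_curlCLM, fderiv_potential_eq a hR]

/-- The test field `curl (χ_R J_a)` is smooth. [folklore] -/
private theorem contDiff_testField (n : ℕ) (R : ℝ) :
    ContDiff ℝ n (curl fun x : EuclideanSpace ℝ (Fin 3) => cutoff R x • crossCLM a x) :=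
  contDiff_curl (n := n) (by exact_mod_cast contDiff_potential a (n := (n + 1 : ℕ)) R)

/-- The test field `curl (χ_R J_a)` has compact support (`R > 0`). [folklore] -/
private theorem hasCompactSupport_testField {R : ℝ} (hR : 0 < R) :
    HasCompactSupport (curl fun x : EuclideanSpace ℝ (Fin 3) => cutoff R x • crossCLM a x) :=
  hasCompactSupport_curl (hasCompactSupport_potential a hR)

/-- The test field `curl (χ_R J_a)` is supported in the closed ball of radius `2R`. [folklore] -/
private theorem tsupport_testField_subset {R : ℝ} (hR : 0 < R) :
    tsupport (curl fun x : EuclideanSpace ℝ (Fin 3) => cutoff R x • crossCLM a x) ⊆ closedBall 0 (2 * R) := by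
  refine (closure_minimal (fun x hx => ?_) (isClosed_tsupport _)).trans (tsupport_potential_subset a hR)
  by_contra hx'
  exact hx (curl_eq_zero_of_notMem_tsupport hx')

/-- The test field `curl (χ_R J_a)` is divergence free. [folklore] -/
private theorem divergence_testField (R : ℝ) (x : EuclideanSpace ℝ (Fin 3)) :
    VectorCalculus.divergence (curl fun x : EuclideanSpace ℝ (Fin 3) => cutoff R x • crossCLM a x) x = 0 :=
  divergence_curl_eq_zero_holds _ (contDiff_potential a (n := 2) R) x

/-- **Uniform bounds for the scaled test fields**: `‖ψ_{R,a}‖ ≤ B₀`, `‖Dψ_{R,a}‖ ≤ B₁ / R`, `‖Δψ_{R,a}‖ ≤ B₂ / R²`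
for all `R > 0` (scaling from the fixed profile `curl (χ_1 J_a) ∈ C_c^∞`). [folklore] -/
private theorem exists_bounds_testField :
    ∃ B₀ B₁ B₂ : ℝ, 0 ≤ B₀ ∧ 0 ≤ B₁ ∧ 0 ≤ B₂ ∧ ∀ R : ℝ, 0 < R → ∀ x : EuclideanSpace ℝ (Fin 3),
      ‖curl (fun x : EuclideanSpace ℝ (Fin 3) => cutoff R x • crossCLM a x) x‖ ≤ B₀ ∧
      ‖fderiv ℝ (curl fun x : EuclideanSpace ℝ (Fin 3) => cutoff R x • crossCLM a x) x‖ ≤ B₁ / R ∧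
        ‖Δ (curl fun x : EuclideanSpace ℝ (Fin 3) => cutoff R x • crossCLM a x) x‖ ≤ B₂ / R ^ 2 := by
  set ψ₁ : EuclideanSpace ℝ (Fin 3) → EuclideanSpace ℝ (Fin 3) :=
    curl fun y : EuclideanSpace ℝ (Fin 3) => cutoff 1 y • crossCLM a y with hψ₁
  have hψ2 : ContDiff ℝ 2 ψ₁ := contDiff_testField a 2 1
  have hψ1 : ContDiff ℝ 1 ψ₁ := hψ2.of_le one_le_two
  have hψc : HasCompactSupport ψ₁ := hasCompactSupport_testField a one_pos
  obtain ⟨B₀, hB₀⟩ := hψ1.continuous.bounded_above_of_compact_support hψc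
  obtain ⟨B₁, hB₁⟩ := (hψ1.continuous_fderiv one_ne_zero).bounded_above_of_compact_support
    (hψc.fderiv (𝕜 := ℝ))
  have hΔc : HasCompactSupport (Δ ψ₁) :=
    HasCompactSupport.intro hψc fun x hx => laplacian_eq_zero_of_notMem_tsupport hx
  obtain ⟨B₂, hB₂⟩ := (continuous_laplacian hψ2).bounded_above_of_compact_support hΔc
  have hB₀0 : 0 ≤ B₀ := (norm_nonneg _).trans (hB₀ 0)
  have hB₁0 : 0 ≤ B₁ := (norm_nonneg _).trans (hB₁ 0)
  have hB₂0 : 0 ≤ B₂ := (norm_nonneg _).trans (hB₂ 0)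
  refine ⟨B₀, B₁, B₂, hB₀0, hB₁0, hB₂0, fun R hR x => ?_⟩
  have hfun : (curl fun x : EuclideanSpace ℝ (Fin 3) => cutoff R x • crossCLM a x) =
      fun x => ψ₁ (R⁻¹ • x) := funext fun x => testField_eq_scale a hR x
  have hRinv : 0 ≤ R⁻¹ := inv_nonneg.2 hR.le
  rw [hfun]
  refine ⟨hB₀ _, ?_, ?_⟩
  · rw [fderiv_comp_smul R⁻¹, norm_smul, Real.norm_of_nonneg hRinv, div_eq_inv_mul]
    exact mul_le_mul_of_nonneg_left (hB₁ _) hRinv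
  · rw [laplacian_comp_smul hψ2 R⁻¹ x, norm_smul, norm_pow, Real.norm_of_nonneg hRinv, inv_pow,
      div_eq_inv_mul]
    exact mul_le_mul_of_nonneg_left (hB₂ _) (by positivity)

/-- `curl J_a = 2a`: the curl of `x ↦ a × x` is the constant vector `2a`. [folklore] -/
private theorem curl_crossCLM (x : EuclideanSpace ℝ (Fin 3)) :
    curl (fun y : EuclideanSpace ℝ (Fin 3) => crossCLM a y) x = (2 : ℝ) • a := by
  have hD : fderiv ℝ (fun y : EuclideanSpace ℝ (Fin 3) => crossCLM a y) x = crossCLM a :=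
    (crossCLM a).fderiv
  ext i
  simp only [curl, hD]
  fin_cases i <;> simp [crossCLM_apply, cross, cross_apply] <;> ring

/-- **The test field is eventually the constant `2a`**: for `‖x‖ < R`, `curl (χ_R J_a)(x) = 2a`. [folklore] -/
private theorem testField_eq_two_smul {R : ℝ} {x : EuclideanSpace ℝ (Fin 3)} (hx : ‖x‖ < R) :
    curl (fun y : EuclideanSpace ℝ (Fin 3) => cutoff R y • crossCLM a y) x = (2 : ℝ) • a := by
  have hR : 0 < R := (norm_nonneg x).trans_lt hx
  have hev : (fun y : EuclideanSpace ℝ (Fin 3) => cutoff R y • crossCLM a y) =ᶠ[𝓝 x]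
      fun y : EuclideanSpace ℝ (Fin 3) => crossCLM a y := by
    have ho : IsOpen {y : EuclideanSpace ℝ (Fin 3) | ‖y‖ < R} := isOpen_lt continuous_norm continuous_const
    filter_upwards [ho.mem_nhds hx] with y hy
    rw [cutoff_eq_one hR (le_of_lt hy), one_smul]
  rw [curl_eq_curlCLM, hev.fderiv_eq, ← curl_eq_curlCLM, curl_crossCLM]

/-- **Pointwise limit of the test fields**: `curl (χ_{n+1} J_a)(x) → 2a` (eventually constant). [folklore] -/
private theorem tendsto_testField (x : EuclideanSpace ℝ (Fin 3)) :
    Tendsto (fun n : ℕ => curl (fun y : EuclideanSpace ℝ (Fin 3) => cutoff ((n : ℝ) + 1) y • crossCLM a y) x)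
      atTop (𝓝 ((2 : ℝ) • a)) := by
  refine tendsto_const_nhds.congr' ?_
  refine (eventually_gt_atTop ⌈‖x‖⌉₊).mono fun n hn => ?_
  have hxn : ‖x‖ < (n : ℝ) + 1 := by
    have h1 := Nat.le_ceil ‖x‖
    have h2 : (⌈‖x‖⌉₊ : ℝ) < n := by exact_mod_cast hn
    linarith
  exact (testField_eq_two_smul a hxn).symm

end TestField

/-! ### §2 The truncated `a`-impulse as a velocity pairing -/

section Pairing

/-- The cyclic triple-product identity `⟪w, a × x⟫ = ⟪a, x × w⟫`. [folklore] -/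
private theorem inner_cross_cyclic_aux (w b x : EuclideanSpace ℝ (Fin 3)) : ⟪w, cross b x⟫ = ⟪b, cross x w⟫ := by
  simp [cross, cross_apply, Fin.sum_univ_three, PiLp.inner_apply]
  ring

/-- **Moving the curl onto the weight**: `∫ χ_R ⟪a, x × curl v⟫ = ∫ ⟪v, curl (χ_R J_a)⟫` for `v ∈ C¹`
(integration by parts for the curl and the triple product). [folklore] -/
private theorem integral_cutoff_mul_inner_cross_curl_eq_inner
    {v : EuclideanSpace ℝ (Fin 3) → EuclideanSpace ℝ (Fin 3)} (hv : ContDiff ℝ 1 v) {R : ℝ} (hR : 0 < R) :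
    ∫ x, cutoff R x * ⟪a, cross x (curl v x)⟫ =
      ∫ x, ⟪v x, curl (fun y : EuclideanSpace ℝ (Fin 3) => cutoff R y • crossCLM a y) x⟫ := by
  rw [← integral_inner_curl_eq_integral_inner_curl hv (contDiff_potential a (n := 1) R)
    (hasCompactSupport_potential a hR)]
  refine integral_congr_ae (Eventually.of_forall fun x => ?_)
  simp only [real_inner_smul_right, crossCLM_apply]
  rw [inner_cross_cyclic_aux (curl v x) a x]

end Pairing

/-! ### §3 The transport and viscous pairings against `curl (χ_R J)` are `O(R^{-1/2})` (energy only) -/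

section SliceBound

/-- **The slice estimate** (verbatim from part IV): for every `ν` and energy level
`E` there is `K` such that for all `R ≥ 1` and every continuous `v` with `∫ ‖v‖² ≤ E`,
`|∫ (⟪v, (v·∇)ψ_R⟫ + ν ⟪v, Δψ_R⟫)| ≤ K / √R`, `ψ_R = curl (χ_R J_a)`. [folklore] -/
private theorem exists_pairing_bound_vec (ν E : ℝ) :
    ∃ K : ℝ, ∀ R : ℝ, 1 ≤ R →
      ∀ v : EuclideanSpace ℝ (Fin 3) → EuclideanSpace ℝ (Fin 3), Continuous v →
        Integrable (fun x => ‖v x‖ ^ 2) → ∫ x, ‖v x‖ ^ 2 ≤ E →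
        |∫ x, (⟪v x, convect v (curl fun y : EuclideanSpace ℝ (Fin 3) => cutoff R y • crossCLM a y) x⟫ +
            ν * ⟪v x, Δ (curl fun y : EuclideanSpace ℝ (Fin 3) => cutoff R y • crossCLM a y) x⟫)| ≤
          K / Real.sqrt R := by
  obtain ⟨B₀, B₁, B₂, -, hB₁, hB₂, hB⟩ := exists_bounds_testField a
  set c₁ : ℝ := (volume (ball (0 : EuclideanSpace ℝ (Fin 3)) 1)).toReal with hc₁
  have hc₁0 : 0 ≤ c₁ := ENNReal.toReal_nonneg
  refine ⟨B₁ * max E 0 + |ν| * B₂ * (8 * c₁ + max E 0) / 2, fun R hR v hvc hv2 hvE => ?_⟩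
  have hR0 : 0 < R := one_pos.trans_le hR
  have hE0 : 0 ≤ E := (integral_nonneg fun x => sq_nonneg _).trans hvE
  rw [max_eq_left hE0]
  set ψ : EuclideanSpace ℝ (Fin 3) → EuclideanSpace ℝ (Fin 3) :=
    curl fun y : EuclideanSpace ℝ (Fin 3) => cutoff R y • crossCLM a y with hψ
  set S : Set (EuclideanSpace ℝ (Fin 3)) := closedBall 0 (2 * R) with hS
  set s : ℝ := Real.sqrt R with hs
  have hs0 : 0 < s := Real.sqrt_pos.2 hR0
  have hss : s * s = R := Real.mul_self_sqrt hR0.le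
  have hs1 : 1 ≤ s := by rw [hs, ← Real.sqrt_one]; exact Real.sqrt_le_sqrt hR
  set lam : ℝ := (R * s)⁻¹ with hlam
  have hlam0 : 0 < lam := inv_pos.2 (mul_pos hR0 hs0)
  set g : EuclideanSpace ℝ (Fin 3) → ℝ := fun x =>
    B₁ / R * ‖v x‖ ^ 2 +
      |ν| * (B₂ / R ^ 2) * ((lam * S.indicator (fun _ => (1 : ℝ)) x + lam⁻¹ * ‖v x‖ ^ 2) / 2)
    with hg
  have hνB : 0 ≤ |ν| * (B₂ / R ^ 2) := by positivity
  have hbound : ∀ x, ‖⟪v x, convect v ψ x⟫ + ν * ⟪v x, Δ ψ x⟫‖ ≤ g x := by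
    intro x
    obtain ⟨-, hD, hL⟩ := hB R hR0 x
    have h1 : |⟪v x, convect v ψ x⟫| ≤ B₁ / R * ‖v x‖ ^ 2 := by
      calc |⟪v x, convect v ψ x⟫| ≤ ‖v x‖ * ‖convect v ψ x‖ := abs_real_inner_le_norm _ _
        _ ≤ ‖v x‖ * (‖fderiv ℝ ψ x‖ * ‖v x‖) :=
            mul_le_mul_of_nonneg_left (ContinuousLinearMap.le_opNorm _ _) (norm_nonneg _)
        _ ≤ ‖v x‖ * (B₁ / R * ‖v x‖) := by gcongr
        _ = B₁ / R * ‖v x‖ ^ 2 := by ring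
    have h2 : |ν * ⟪v x, Δ ψ x⟫| ≤
        |ν| * (B₂ / R ^ 2) * (‖v x‖ * S.indicator (fun _ => (1 : ℝ)) x) := by
      rw [abs_mul]
      by_cases hx : x ∈ S
      · rw [indicator_of_mem hx, mul_one]
        calc |ν| * |⟪v x, Δ ψ x⟫| ≤ |ν| * (‖v x‖ * ‖Δ ψ x‖) :=
              mul_le_mul_of_nonneg_left (abs_real_inner_le_norm _ _) (abs_nonneg _)
          _ ≤ |ν| * (‖v x‖ * (B₂ / R ^ 2)) := by gcongr
          _ = |ν| * (B₂ / R ^ 2) * ‖v x‖ := by ring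
      · have hΔ0 : Δ ψ x = 0 :=
          laplacian_eq_zero_of_notMem_tsupport fun h =>
            hx (tsupport_testField_subset a hR0 h)
        rw [hΔ0, inner_zero_right, abs_zero, mul_zero, indicator_of_notMem hx, mul_zero, mul_zero]
    have h3 : ‖v x‖ * S.indicator (fun _ => (1 : ℝ)) x ≤
        (lam * S.indicator (fun _ => (1 : ℝ)) x + lam⁻¹ * ‖v x‖ ^ 2) / 2 := by
      by_cases hx : x ∈ S
      · rw [indicator_of_mem hx, mul_one, mul_one, le_div_iff₀ two_pos]
        have key : ‖v x‖ * 2 * lam ≤ (lam + lam⁻¹ * ‖v x‖ ^ 2) * lam := by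
          have e : (lam + lam⁻¹ * ‖v x‖ ^ 2) * lam = lam ^ 2 + ‖v x‖ ^ 2 := by
            rw [add_mul, ← pow_two, mul_comm (lam⁻¹ * _) lam, ← mul_assoc, mul_inv_cancel₀ hlam0.ne',
              one_mul]
          rw [e]
          nlinarith [sq_nonneg (lam - ‖v x‖)]
        exact le_of_mul_le_mul_right key hlam0
      · rw [indicator_of_notMem hx, mul_zero, mul_zero, zero_add]
        positivity
    calc ‖⟪v x, convect v ψ x⟫ + ν * ⟪v x, Δ ψ x⟫‖
        = |⟪v x, convect v ψ x⟫ + ν * ⟪v x, Δ ψ x⟫| := Real.norm_eq_abs _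
      _ ≤ |⟪v x, convect v ψ x⟫| + |ν * ⟪v x, Δ ψ x⟫| := abs_add_le _ _
      _ ≤ B₁ / R * ‖v x‖ ^ 2 + |ν| * (B₂ / R ^ 2) * (‖v x‖ * S.indicator (fun _ => (1 : ℝ)) x) :=
          add_le_add h1 h2
      _ ≤ g x := by
          simp only [hg]
          exact add_le_add le_rfl (mul_le_mul_of_nonneg_left h3 hνB)
  have hind : Integrable (S.indicator fun _ => (1 : ℝ)) :=
    (integrable_indicator_iff measurableSet_closedBall).2
      (integrableOn_const measure_closedBall_lt_top.ne)
  have i1 : Integrable (fun x => B₁ / R * ‖v x‖ ^ 2) := hv2.const_mul _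
  have i2 : Integrable (fun x => lam * S.indicator (fun _ => (1 : ℝ)) x) := hind.const_mul _
  have i3 : Integrable (fun x => lam⁻¹ * ‖v x‖ ^ 2) := hv2.const_mul _
  have i4 : Integrable (fun x =>
      (lam * S.indicator (fun _ => (1 : ℝ)) x + lam⁻¹ * ‖v x‖ ^ 2) / 2) := (i2.add i3).div_const 2
  have i5 : Integrable (fun x =>
      |ν| * (B₂ / R ^ 2) * ((lam * S.indicator (fun _ => (1 : ℝ)) x + lam⁻¹ * ‖v x‖ ^ 2) / 2)) :=
    i4.const_mul _
  have hgi : Integrable g := by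
    rw [hg]
    exact i1.add i5
  have hvol : volume.real (closedBall (0 : EuclideanSpace ℝ (Fin 3)) (2 * R)) = (2 * R) ^ 3 * c₁ := by
    rw [measureReal_def, Measure.addHaar_closedBall _ _ (by positivity), ENNReal.toReal_mul,
      finrank_euclideanSpace_fin, ENNReal.toReal_ofReal (by positivity)]
  have hIg : ∫ x, g x =
      B₁ / R * (∫ x, ‖v x‖ ^ 2) +
        |ν| * (B₂ / R ^ 2) * ((lam * ((2 * R) ^ 3 * c₁) + lam⁻¹ * ∫ x, ‖v x‖ ^ 2) / 2) := by
    simp only [hg]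
    rw [integral_add i1 i5, integral_const_mul, integral_const_mul, integral_div,
      integral_add i2 i3, integral_const_mul, integral_const_mul,
      integral_indicator_const _ measurableSet_closedBall, hvol, smul_eq_mul, mul_one]
  calc |∫ x, (⟪v x, convect v ψ x⟫ + ν * ⟪v x, Δ ψ x⟫)|
      = ‖∫ x, (⟪v x, convect v ψ x⟫ + ν * ⟪v x, Δ ψ x⟫)‖ := (Real.norm_eq_abs _).symm
    _ ≤ ∫ x, g x := norm_integral_le_of_norm_le hgi (Eventually.of_forall hbound)
    _ = B₁ / R * (∫ x, ‖v x‖ ^ 2) +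
        |ν| * (B₂ / R ^ 2) * ((lam * ((2 * R) ^ 3 * c₁) + lam⁻¹ * ∫ x, ‖v x‖ ^ 2) / 2) := hIg
    _ ≤ B₁ / R * E + |ν| * (B₂ / R ^ 2) * ((lam * ((2 * R) ^ 3 * c₁) + lam⁻¹ * E) / 2) := by
        gcongr
    _ = B₁ * E / (s * s) + |ν| * B₂ * (8 * c₁ + E) / 2 / s := by
        rw [hlam, ← hss]
        field_simp
        ring
    _ ≤ B₁ * E / s + |ν| * B₂ * (8 * c₁ + E) / 2 / s := by
        gcongr ?_ + _
        exact div_le_div_of_nonneg_left (by positivity) hs0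
          (le_mul_of_one_le_left hs0.le hs1)
    _ = (B₁ * E + |ν| * B₂ * (8 * c₁ + E) / 2) / s := by ring

end SliceBound

/-! ### §4 Along a finite-energy classical forced solution: the pairing integrand and its limit -/

section Dynamics

variable {T ν : ℝ} {f u : ℝ → EuclideanSpace ℝ (Fin 3) → EuclideanSpace ℝ (Fin 3)}
  {p : ℝ → EuclideanSpace ℝ (Fin 3) → ℝ}

/-- The `a`-component `⟪a, x × curl v⟫` of the impulse density of a `C¹` field is continuous. [folklore] -/
private theorem continuous_inner_cross_curl {v : EuclideanSpace ℝ (Fin 3) → EuclideanSpace ℝ (Fin 3)}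
    (hv : ContDiff ℝ 1 v) : Continuous fun x => ⟪a, cross x (curl v x)⟫ :=
  continuous_const.inner (crossCLM.continuous₂.comp (continuous_id.prodMk (continuous_curl hv)))

/-- A slice of a field continuous on `[0, T] × ℝ³` is continuous. [folklore] -/
private theorem continuous_slice_of_continuousOn {w : ℝ → EuclideanSpace ℝ (Fin 3) → EuclideanSpace ℝ (Fin 3)}
    (hw : ContinuousOn (uncurry w) (Icc 0 T ×ˢ univ)) {τ : ℝ} (hτ : τ ∈ Icc 0 T) : Continuous (w τ) := by
  have h1 : ContinuousOn (fun x : EuclideanSpace ℝ (Fin 3) => uncurry w (τ, x)) univ :=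
    hw.comp (continuous_const.prodMk continuous_id).continuousOn fun x _ => mk_mem_prod hτ (mem_univ x)
  exact continuousOn_univ.1 h1

/-- Off the ball of radius `2R` the test field, its Jacobian and its Laplacian vanish. [folklore] -/
private theorem testField_eq_zero_of_lt' {R : ℝ} (hR : 0 < R) {x : EuclideanSpace ℝ (Fin 3)} (hx : 2 * R < ‖x‖) :
    curl (fun y : EuclideanSpace ℝ (Fin 3) => cutoff R y • crossCLM a y) x = 0 ∧
    fderiv ℝ (curl fun y : EuclideanSpace ℝ (Fin 3) => cutoff R y • crossCLM a y) x = 0 ∧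
    Δ (curl fun y : EuclideanSpace ℝ (Fin 3) => cutoff R y • crossCLM a y) x = 0 := by
  have hx' : x ∉ tsupport (curl fun y : EuclideanSpace ℝ (Fin 3) => cutoff R y • crossCLM a y) := fun h => by
    have := tsupport_testField_subset a hR h
    rw [mem_closedBall, dist_zero_right] at this
    linarith
  exact ⟨image_eq_zero_of_notMem_tsupport hx', fderiv_of_notMem_tsupport ℝ hx',
    laplacian_eq_zero_of_notMem_tsupport hx'⟩

/-- **The force pairing against the test fields tends to twice the `a`-mean**: for a continuous integrable slice
`g`, `∫ ⟪g, curl (χ_{n+1} J_a)⟫ dx → 2 ∫ ⟪a, g⟫ dx` (the test fields are bounded by `B₀` and eventually equal to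
`2a` at every point; dominated convergence). [folklore] -/
private theorem tendsto_integral_inner_testField {g : EuclideanSpace ℝ (Fin 3) → EuclideanSpace ℝ (Fin 3)}
    (hg : Continuous g) (hgi : Integrable g) :
    Tendsto (fun n : ℕ => ∫ x, ⟪g x, curl (fun y : EuclideanSpace ℝ (Fin 3) => cutoff ((n : ℝ) + 1) y • crossCLM a y) x⟫)
      atTop (𝓝 (2 * ∫ x, ⟪a, g x⟫)) := by
  obtain ⟨B₀, B₁, B₂, hB₀, -, -, hB⟩ := exists_bounds_testField a
  have hlim : ∫ x, ⟪g x, (2 : ℝ) • a⟫ = 2 * ∫ x, ⟪a, g x⟫ := by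
    rw [← integral_const_mul]
    refine integral_congr_ae (Eventually.of_forall fun x => ?_)
    simp only [real_inner_smul_right]
    rw [real_inner_comm]
  rw [← hlim]
  refine tendsto_integral_filter_of_dominated_convergence (fun x => B₀ * ‖g x‖) ?_ ?_ (hgi.norm.const_mul B₀) ?_
  · exact Eventually.of_forall fun n =>
      (hg.inner (contDiff_testField a 0 _).continuous).aestronglyMeasurable
  · refine Eventually.of_forall fun n => Eventually.of_forall fun x => ?_
    have hn0 : (0 : ℝ) < (n : ℝ) + 1 := by positivity
    calc ‖⟪g x, curl (fun y : EuclideanSpace ℝ (Fin 3) => cutoff ((n : ℝ) + 1) y • crossCLM a y) x⟫‖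
        ≤ ‖g x‖ * ‖curl (fun y : EuclideanSpace ℝ (Fin 3) => cutoff ((n : ℝ) + 1) y • crossCLM a y) x‖ :=
          norm_inner_le_norm _ _
      _ ≤ ‖g x‖ * B₀ := by gcongr; exact (hB _ hn0 x).1
      _ = B₀ * ‖g x‖ := mul_comm _ _
  · exact Eventually.of_forall fun x => tendsto_const_nhds.inner (tendsto_testField a x)

/-- **The pairing integrand and its behaviour** along a finite-energy classical forced solution on `[0, T]`
(`0 < T`, uniform energy level `∫ ‖u(τ)‖² ≤ E`, integrable majorant `F` of the force slices): with
`ψ_n = curl (χ_{n+1} J_a)` and the integrand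
`Θ_n(τ) = ∫ (⟪u,(u·∇)ψ_n⟫ + ν⟪u,Δψ_n⟫ + ⟪f,ψ_n⟫) + ∫ p div ψ_n` of
`IsClassicalNSSolutionOn.integral_inner_sub_eq_pressure`, for every `τ ∈ [0, T]`:
`|Θ_n(τ)| ≤ M` uniformly in `n` and `Θ_n(τ) → 2 ∫ ⟪a, f(τ, x)⟫ dx` (the transport and viscous pairings are
`O(1/√n)` by the slice estimate; the pressure pairs with `div ψ_n = 0`). [cite: Leray1934, §III (17)] -/
private theorem IsClassicalNSSolutionOn.pairing_integrand_bound_and_tendsto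
    (h : IsClassicalNSSolutionOn (Icc 0 T) ν f u p) (hT : 0 < T) {E : ℝ}
    (h2 : ∀ τ ∈ Icc 0 T, Integrable fun x => ‖u τ x‖ ^ 2) (hE : ∀ τ ∈ Icc 0 T, ∫ x, ‖u τ x‖ ^ 2 ≤ E)
    {F : EuclideanSpace ℝ (Fin 3) → ℝ} (hF : Integrable F) (hfF : ∀ τ ∈ Icc 0 T, ∀ x, ‖f τ x‖ ≤ F x) :
    ∃ M : ℝ, ∀ τ ∈ Icc 0 T,
      (∀ n : ℕ, |(∫ x, (⟪u τ x, convect (u τ)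
            (curl fun y : EuclideanSpace ℝ (Fin 3) => cutoff ((n : ℝ) + 1) y • crossCLM a y) x⟫ +
          ν * ⟪u τ x, Δ (curl fun y : EuclideanSpace ℝ (Fin 3) => cutoff ((n : ℝ) + 1) y • crossCLM a y) x⟫ +
          ⟪f τ x, curl (fun y : EuclideanSpace ℝ (Fin 3) => cutoff ((n : ℝ) + 1) y • crossCLM a y) x⟫)) +
        ∫ x, p τ x * VectorCalculus.divergence
          (curl fun y : EuclideanSpace ℝ (Fin 3) => cutoff ((n : ℝ) + 1) y • crossCLM a y) x| ≤ M) ∧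
      Tendsto (fun n : ℕ => (∫ x, (⟪u τ x, convect (u τ)
            (curl fun y : EuclideanSpace ℝ (Fin 3) => cutoff ((n : ℝ) + 1) y • crossCLM a y) x⟫ +
          ν * ⟪u τ x, Δ (curl fun y : EuclideanSpace ℝ (Fin 3) => cutoff ((n : ℝ) + 1) y • crossCLM a y) x⟫ +
          ⟪f τ x, curl (fun y : EuclideanSpace ℝ (Fin 3) => cutoff ((n : ℝ) + 1) y • crossCLM a y) x⟫)) +
        ∫ x, p τ x * VectorCalculus.divergence
          (curl fun y : EuclideanSpace ℝ (Fin 3) => cutoff ((n : ℝ) + 1) y • crossCLM a y) x)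
        atTop (𝓝 (2 * ∫ x, ⟪a, f τ x⟫)) := by
  obtain ⟨K, hK⟩ := exists_pairing_bound_vec a ν E
  obtain ⟨B₀, B₁, B₂, hB₀, -, -, hB⟩ := exists_bounds_testField a
  have hfc : ContinuousOn (uncurry f) (Icc 0 T ×ˢ univ) :=
    (h.isSmoothSpaceTimeOn_force (uniqueDiffOn_Icc hT)).continuousOn
  refine ⟨max K 0 + B₀ * ∫ x, F x, fun τ hτ => ?_⟩
  -- notation for the slices at time `τ`
  have hu1 : Continuous (u τ) := (h.contDiff_velocity hτ).continuous
  have hf1 : Continuous (f τ) := continuous_slice_of_continuousOn hfc hτ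
  have hfi : Integrable (f τ) := hF.mono' hf1.aestronglyMeasurable (Eventually.of_forall (hfF τ hτ))
  set ψ : ℕ → EuclideanSpace ℝ (Fin 3) → EuclideanSpace ℝ (Fin 3) := fun n =>
    curl fun y : EuclideanSpace ℝ (Fin 3) => cutoff ((n : ℝ) + 1) y • crossCLM a y with hψ
  have hn0 : ∀ n : ℕ, (0 : ℝ) < (n : ℝ) + 1 := fun n => by positivity
  have hn1 : ∀ n : ℕ, (1 : ℝ) ≤ (n : ℝ) + 1 := fun n => le_add_of_nonneg_left (Nat.cast_nonneg n)
  have hψ2 : ∀ n, ContDiff ℝ 2 (ψ n) := fun n => contDiff_testField a 2 _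
  -- the pressure term vanishes
  have hdiv : ∀ n, (fun x => p τ x * VectorCalculus.divergence (ψ n) x) = fun _ => 0 := fun n => by
    funext x
    simp only [hψ, divergence_testField a, mul_zero]
  -- integrability of the two pieces (compact support of `ψ n`)
  have hK2 : ∀ n : ℕ, IsCompact (closedBall (0 : EuclideanSpace ℝ (Fin 3)) (2 * ((n : ℝ) + 1))) :=
    fun n => isCompact_closedBall _ _
  have hout : ∀ n : ℕ, ∀ x ∉ closedBall (0 : EuclideanSpace ℝ (Fin 3)) (2 * ((n : ℝ) + 1)),
      ψ n x = 0 ∧ fderiv ℝ (ψ n) x = 0 ∧ Δ (ψ n) x = 0 := fun n x hx => by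
    rw [mem_closedBall, dist_zero_right, not_le] at hx
    exact testField_eq_zero_of_lt' a (hn0 n) hx
  have iA : ∀ n, Integrable fun x => ⟪u τ x, convect (u τ) (ψ n) x⟫ + ν * ⟪u τ x, Δ (ψ n) x⟫ := by
    intro n
    refine Continuous.integrable_of_hasCompactSupport ?_ (HasCompactSupport.intro (hK2 n) fun x hx => ?_)
    · exact (hu1.inner ((((hψ2 n).continuous_fderiv (by simp)).clm_apply hu1).congr fun x => rfl)).add
        (continuous_const.mul (hu1.inner (continuous_laplacian (hψ2 n))))
    · obtain ⟨-, h1, h2⟩ := hout n x hx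
      simp [convect, h1, h2]
  have iF : ∀ n, Integrable fun x => ⟪f τ x, ψ n x⟫ := fun n =>
    integrable_inner_of_hasCompactSupport_right hf1 (hψ2 n).continuous
      (hasCompactSupport_testField a (hn0 n))
  -- the integrand splits
  have hsplit : ∀ n, (∫ x, (⟪u τ x, convect (u τ) (ψ n) x⟫ + ν * ⟪u τ x, Δ (ψ n) x⟫ + ⟪f τ x, ψ n x⟫)) +
      ∫ x, p τ x * VectorCalculus.divergence (ψ n) x =
      (∫ x, (⟪u τ x, convect (u τ) (ψ n) x⟫ + ν * ⟪u τ x, Δ (ψ n) x⟫)) + ∫ x, ⟪f τ x, ψ n x⟫ := by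
    intro n
    rw [hdiv n, integral_zero, add_zero, integral_add (iA n) (iF n)]
  -- bounds on the pieces
  have hA : ∀ n, |∫ x, (⟪u τ x, convect (u τ) (ψ n) x⟫ + ν * ⟪u τ x, Δ (ψ n) x⟫)| ≤
      K / Real.sqrt ((n : ℝ) + 1) := fun n => hK _ (hn1 n) (u τ) hu1 (h2 τ hτ) (hE τ hτ)
  have hΦ : ∀ n, |∫ x, ⟪f τ x, ψ n x⟫| ≤ B₀ * ∫ x, F x := by
    intro n
    rw [← Real.norm_eq_abs, ← integral_const_mul]
    refine norm_integral_le_of_norm_le (hF.const_mul B₀) (Eventually.of_forall fun x => ?_)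
    calc ‖⟪f τ x, ψ n x⟫‖ ≤ ‖f τ x‖ * ‖ψ n x‖ := norm_inner_le_norm _ _
      _ ≤ F x * B₀ := by
          gcongr
          · exact (norm_nonneg _).trans (hfF τ hτ x)
          · exact hfF τ hτ x
          · exact (hB _ (hn0 n) x).1
      _ = B₀ * F x := mul_comm _ _
  refine ⟨fun n => ?_, ?_⟩
  · rw [hsplit n]
    have hKn : K / Real.sqrt ((n : ℝ) + 1) ≤ max K 0 := by
      rcases le_or_gt K 0 with hK0 | hK0
      · exact (div_nonpos_of_nonpos_of_nonneg hK0 (Real.sqrt_nonneg _)).trans (le_max_right _ _)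
      · exact (div_le_self hK0.le (Real.one_le_sqrt.2 (hn1 n))).trans (le_max_left _ _)
    calc |(∫ x, (⟪u τ x, convect (u τ) (ψ n) x⟫ + ν * ⟪u τ x, Δ (ψ n) x⟫)) + ∫ x, ⟪f τ x, ψ n x⟫|
        ≤ |∫ x, (⟪u τ x, convect (u τ) (ψ n) x⟫ + ν * ⟪u τ x, Δ (ψ n) x⟫)| + |∫ x, ⟪f τ x, ψ n x⟫| :=
          abs_add_le _ _
      _ ≤ max K 0 + B₀ * ∫ x, F x := add_le_add ((hA n).trans hKn) (hΦ n)
  · have hA0 : Tendsto (fun n : ℕ => ∫ x, (⟪u τ x, convect (u τ) (ψ n) x⟫ + ν * ⟪u τ x, Δ (ψ n) x⟫))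
        atTop (𝓝 0) := by
      have hrate : Tendsto (fun n : ℕ => K / Real.sqrt ((n : ℝ) + 1)) atTop (𝓝 0) := by
        have h1 : Tendsto (fun n : ℕ => Real.sqrt ((n : ℝ) + 1)) atTop atTop :=
          Real.tendsto_sqrt_atTop.comp (tendsto_natCast_atTop_atTop.atTop_add tendsto_const_nhds)
        exact tendsto_const_nhds.div_atTop h1
      refine squeeze_zero_norm (fun n => ?_) hrate
      rw [Real.norm_eq_abs]
      exact hA n
    have hΦlim := tendsto_integral_inner_testField a hf1 hfi
    have := hA0.add hΦlim
    rw [zero_add] at this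
    exact this.congr fun n => (hsplit n).symm

/-- **The pairing integrand is continuous in time** (each of its two integrals is `∫ χ_{4R}(x) G(τ, x) dx` with
`G` continuous on the slab; Mathlib `continuousOn_integral_of_compact_support`). [folklore] -/
private theorem IsClassicalNSSolutionOn.continuousOn_pairing_integrand
    (h : IsClassicalNSSolutionOn (Icc 0 T) ν f u p) (hT : 0 < T) {R : ℝ} (hR : 0 < R) :
    ContinuousOn (fun τ => (∫ x, (⟪u τ x, convect (u τ)
            (curl fun y : EuclideanSpace ℝ (Fin 3) => cutoff R y • crossCLM a y) x⟫ +
          ν * ⟪u τ x, Δ (curl fun y : EuclideanSpace ℝ (Fin 3) => cutoff R y • crossCLM a y) x⟫ +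
          ⟪f τ x, curl (fun y : EuclideanSpace ℝ (Fin 3) => cutoff R y • crossCLM a y) x⟫)) +
        ∫ x, p τ x * VectorCalculus.divergence
          (curl fun y : EuclideanSpace ℝ (Fin 3) => cutoff R y • crossCLM a y) x) (Icc 0 T) := by
  set ψ : EuclideanSpace ℝ (Fin 3) → EuclideanSpace ℝ (Fin 3) :=
    curl fun y : EuclideanSpace ℝ (Fin 3) => cutoff R y • crossCLM a y with hψ
  have hψ2 : ContDiff ℝ 2 ψ := contDiff_testField a 2 _
  have hU := uniqueDiffOn_Icc hT
  have huc : ContinuousOn (uncurry u) (Icc 0 T ×ˢ univ) := h.smooth_velocity.continuousOn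
  have hfc : ContinuousOn (uncurry f) (Icc 0 T ×ˢ univ) := (h.isSmoothSpaceTimeOn_force hU).continuousOn
  have hpc : ContinuousOn (uncurry p) (Icc 0 T ×ˢ univ) := h.smooth_pressure.continuousOn
  -- the cut-off `χ_{2R}` is `1` on the support of `ψ`
  set φ : EuclideanSpace ℝ (Fin 3) → ℝ := cutoff (2 * R) with hφ
  have hφc : Continuous φ := (contDiff_cutoff (n := 0) _).continuous
  have hφs : HasCompactSupport φ := hasCompactSupport_cutoff (by positivity)
  have hφψ : ∀ x, ∀ v : ℝ, (‖x‖ ≤ 2 * R → True) →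
      (2 * R < ‖x‖ → v = 0) → φ x * v = v := by
    intro x v _ h0
    by_cases hx : ‖x‖ ≤ 2 * R
    · rw [hφ, cutoff_eq_one (by positivity) hx, one_mul]
    · rw [not_le] at hx
      rw [h0 hx, mul_zero]
  -- the two scalar integrands as functions on the slab
  set G₁ : ℝ × EuclideanSpace ℝ (Fin 3) → ℝ := fun z =>
    ⟪u z.1 z.2, convect (u z.1) ψ z.2⟫ + ν * ⟪u z.1 z.2, Δ ψ z.2⟫ + ⟪f z.1 z.2, ψ z.2⟫ with hG₁
  set G₂ : ℝ × EuclideanSpace ℝ (Fin 3) → ℝ := fun z => p z.1 z.2 * VectorCalculus.divergence ψ z.2 with hG₂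
  have hψfc : Continuous fun x => fderiv ℝ ψ x := hψ2.continuous_fderiv (by simp)
  have hG₁c : ContinuousOn G₁ (Icc 0 T ×ˢ univ) := by
    have hψ' : ContinuousOn (fun z : ℝ × EuclideanSpace ℝ (Fin 3) => ψ z.2) (Icc 0 T ×ˢ univ) :=
      (hψ2.continuous.comp continuous_snd).continuousOn
    have hDψ : ContinuousOn (fun z : ℝ × EuclideanSpace ℝ (Fin 3) => fderiv ℝ ψ z.2) (Icc 0 T ×ˢ univ) :=
      (hψfc.comp continuous_snd).continuousOn
    have hΔψ : ContinuousOn (fun z : ℝ × EuclideanSpace ℝ (Fin 3) => Δ ψ z.2) (Icc 0 T ×ˢ univ) :=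
      ((continuous_laplacian hψ2).comp continuous_snd).continuousOn
    exact ((huc.inner (hDψ.clm_apply huc)).add (continuousOn_const.mul (huc.inner hΔψ))).add
      (hfc.inner hψ')
  have hG₂c : ContinuousOn G₂ (Icc 0 T ×ˢ univ) :=
    hpc.mul ((continuous_divergence hψfc).comp continuous_snd).continuousOn
  have e₁ : ∀ τ, (∫ x, (⟪u τ x, convect (u τ) ψ x⟫ + ν * ⟪u τ x, Δ ψ x⟫ + ⟪f τ x, ψ x⟫)) =
      ∫ x, φ x * G₁ (τ, x) := by
    intro τ
    refine integral_congr_ae (Eventually.of_forall fun x => ?_)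
    refine (hφψ x _ (fun _ => trivial) fun hx => ?_).symm
    obtain ⟨h0, h1, h2⟩ := testField_eq_zero_of_lt' a hR hx
    simp only [crossCLM_apply] at h0 h1 h2
    simp [hψ, convect, h0, h1, h2]
  have e₂ : ∀ τ, (∫ x, p τ x * VectorCalculus.divergence ψ x) = ∫ x, φ x * G₂ (τ, x) := by
    intro τ
    refine integral_congr_ae (Eventually.of_forall fun x => ?_)
    simp only [hG₂, hψ, divergence_testField a, mul_zero]
  have hc₁ := continuousOn_integral_mul_of_continuousOn hφc hφs hG₁c
  have hc₂ := continuousOn_integral_mul_of_continuousOn hφc hφs hG₂c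
  refine ((hc₁.add hc₂).congr fun τ _ => ?_)
  simp only [Pi.add_apply, e₁ τ, e₂ τ]

/-! ### §5 The `a`-component of the impulse balance from the energy -/

/-- **TRUNCATED IMPULSE BALANCE IN THE DIRECTION `a` (Saffman (3.2.9) from the energy alone).** Let `(u, p)` be a
classical solution of the Navier–Stokes system (any viscosity `ν`) with force `f` on `[0, T] × ℝ³`, `0 < T`, with a
uniform energy level `∫ ‖u(τ)‖² ≤ E` and an integrable majorant of the force slices. Then for `0 ≤ s ≤ t ≤ T` and
every vector `a`:
`∫ χ_n ⟪a, x × ω(t)⟫ dx − ∫ χ_n ⟪a, x × ω(s)⟫ dx → 2 ∫ₛᵗ ∫ ⟪a, f⟫ dx dτ` (`χ_n = cutoff (n+1)`). NO decay of the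
vorticity is assumed. [cite: Saffman1992, §3.2 eq. (3.2.9)] -/
theorem IsClassicalNSSolutionOn.tendsto_integral_cutoff_inner_cross_vorticity_sub
    (h : IsClassicalNSSolutionOn (Icc 0 T) ν f u p) (hT : 0 < T) {E : ℝ}
    (h2 : ∀ τ ∈ Icc 0 T, Integrable fun x => ‖u τ x‖ ^ 2) (hE : ∀ τ ∈ Icc 0 T, ∫ x, ‖u τ x‖ ^ 2 ≤ E)
    {F : EuclideanSpace ℝ (Fin 3) → ℝ} (hF : Integrable F) (hfF : ∀ τ ∈ Icc 0 T, ∀ x, ‖f τ x‖ ≤ F x)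
    {s t : ℝ} (hs : 0 ≤ s) (hst : s ≤ t) (ht : t ≤ T) :
    Tendsto (fun n : ℕ => (∫ x, cutoff ((n : ℝ) + 1) x * ⟪a, cross x (curl (u t) x)⟫) -
        ∫ x, cutoff ((n : ℝ) + 1) x * ⟪a, cross x (curl (u s) x)⟫) atTop
      (𝓝 (2 * ∫ τ in s..t, ∫ x, ⟪a, f τ x⟫)) := by
  obtain ⟨M, hM⟩ := h.pairing_integrand_bound_and_tendsto a hT h2 hE hF hfF
  have htT : t ∈ Icc 0 T := ⟨hs.trans hst, ht⟩
  have hsT : s ∈ Icc 0 T := ⟨hs, hst.trans ht⟩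
  have hIcc : ∀ τ ∈ Ι s t, τ ∈ Icc 0 T := fun τ hτ => by
    rw [uIoc_of_le hst] at hτ
    exact ⟨hs.trans hτ.1.le, hτ.2.trans ht⟩
  have hn0 : ∀ n : ℕ, (0 : ℝ) < (n : ℝ) + 1 := fun n => by positivity
  -- the truncated impulses are velocity pairings, and the pairing identity
  have hpair : ∀ n : ℕ, (∫ x, cutoff ((n : ℝ) + 1) x * ⟪a, cross x (curl (u t) x)⟫) -
      (∫ x, cutoff ((n : ℝ) + 1) x * ⟪a, cross x (curl (u s) x)⟫) =
      ∫ τ in s..t, ((∫ x, (⟪u τ x, convect (u τ)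
            (curl fun y : EuclideanSpace ℝ (Fin 3) => cutoff ((n : ℝ) + 1) y • crossCLM a y) x⟫ +
          ν * ⟪u τ x, Δ (curl fun y : EuclideanSpace ℝ (Fin 3) => cutoff ((n : ℝ) + 1) y • crossCLM a y) x⟫ +
          ⟪f τ x, curl (fun y : EuclideanSpace ℝ (Fin 3) => cutoff ((n : ℝ) + 1) y • crossCLM a y) x⟫)) +
        ∫ x, p τ x * VectorCalculus.divergence
          (curl fun y : EuclideanSpace ℝ (Fin 3) => cutoff ((n : ℝ) + 1) y • crossCLM a y) x) := by
    intro n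
    rw [integral_cutoff_mul_inner_cross_curl_eq_inner a ((h.contDiff_velocity htT).of_le (by norm_cast)) (hn0 n),
      integral_cutoff_mul_inner_cross_curl_eq_inner a ((h.contDiff_velocity hsT).of_le (by norm_cast)) (hn0 n),
      h.integral_inner_sub_eq_pressure hT (contDiff_testField a 2 _)
        (hasCompactSupport_testField a (hn0 n)) hs hst ht]
  simp_rw [hpair]
  rw [← intervalIntegral.integral_const_mul]
  refine intervalIntegral.tendsto_integral_filter_of_dominated_convergence (fun _ => M) ?_ ?_ ?_ ?_
  · refine Eventually.of_forall fun n => ?_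
    refine ContinuousOn.aestronglyMeasurable ?_ measurableSet_uIoc
    refine (h.continuousOn_pairing_integrand a hT (hn0 n)).mono fun τ hτ => hIcc τ hτ
  · exact Eventually.of_forall fun n => Eventually.of_forall fun τ hτ => by
      rw [Real.norm_eq_abs]; exact (hM τ (hIcc τ hτ)).1 n
  · exact intervalIntegrable_const
  · exact Eventually.of_forall fun τ hτ => (hM τ (hIcc τ hτ)).2

/-- **THE `a`-COMPONENT OF THE IMPULSE BALANCE FROM THE ENERGY (Saffman (3.2.9)).** Under the hypotheses of
`tendsto_integral_cutoff_inner_cross_vorticity_sub`, if the densities `⟪a, x × ω⟫` at the two times `s ≤ t` are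
integrable then `∫ ⟪a, x × ω(t)⟫ dx − ∫ ⟪a, x × ω(s)⟫ dx = 2 ∫ₛᵗ ∫ ⟪a, f⟫ dx dτ`.
[cite: Saffman1992, §3.2 eq. (3.2.9)] -/
theorem IsClassicalNSSolutionOn.integral_inner_cross_vorticity_sub_eq_of_energy
    (h : IsClassicalNSSolutionOn (Icc 0 T) ν f u p) (hT : 0 < T) {E : ℝ}
    (h2 : ∀ τ ∈ Icc 0 T, Integrable fun x => ‖u τ x‖ ^ 2) (hE : ∀ τ ∈ Icc 0 T, ∫ x, ‖u τ x‖ ^ 2 ≤ E)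
    {F : EuclideanSpace ℝ (Fin 3) → ℝ} (hF : Integrable F) (hfF : ∀ τ ∈ Icc 0 T, ∀ x, ‖f τ x‖ ≤ F x)
    {s t : ℝ} (hs : 0 ≤ s) (hst : s ≤ t) (ht : t ≤ T)
    (hIs : Integrable fun x => ⟪a, cross x (curl (u s) x)⟫) (hIt : Integrable fun x => ⟪a, cross x (curl (u t) x)⟫) :
    (∫ x, ⟪a, cross x (curl (u t) x)⟫) - ∫ x, ⟪a, cross x (curl (u s) x)⟫ = 2 * ∫ τ in s..t, ∫ x, ⟪a, f τ x⟫ :=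
  tendsto_nhds_unique ((tendsto_integral_cutoff_mul hIt).sub (tendsto_integral_cutoff_mul hIs))
    (h.tendsto_integral_cutoff_inner_cross_vorticity_sub a hT h2 hE hF hfF hs hst ht)

/-! ### §6 The vector law -/

/-- A field continuous on `[a, b] × ℝ³` and dominated there by an integrable function of `x` is integrable for
`dt|_(a,b) ⊗ dx`. [folklore] -/
private theorem integrable_prod_of_dominated' {D : ℝ × EuclideanSpace ℝ (Fin 3) → EuclideanSpace ℝ (Fin 3)}
    {a₀ b₀ : ℝ} (hD : ContinuousOn D (Icc a₀ b₀ ×ˢ univ)) {G : EuclideanSpace ℝ (Fin 3) → ℝ} (hG : Integrable G)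
    (hDG : ∀ s ∈ Icc a₀ b₀, ∀ x, ‖D (s, x)‖ ≤ G x) :
    Integrable D (((volume : Measure ℝ).restrict (Ioo a₀ b₀)).prod (volume : Measure (EuclideanSpace ℝ (Fin 3)))) := by
  have h1 : Integrable (fun z : ℝ × EuclideanSpace ℝ (Fin 3) => (1 : ℝ) * G z.2)
      (((volume : Measure ℝ).restrict (Ioo a₀ b₀)).prod (volume : Measure (EuclideanSpace ℝ (Fin 3)))) :=
    (integrable_const (1 : ℝ)).mul_prod hG
  refine Integrable.mono' (g := fun z => G z.2) (by simpa only [one_mul] using h1)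
    (aestronglyMeasurable_prod_of_continuousOn hD) ?_
  rw [Measure.restrict_prod_eq_prod_univ]
  filter_upwards [ae_restrict_mem (measurableSet_Ioo.prod MeasurableSet.univ)] with z hz
  exact hDG z.1 (Ioo_subset_Icc_self hz.1) z.2

/-- The time integral of the force's spatial mean pairs with a fixed vector componentwise: under a common integrable
majorant on the slab, `⟪a, ∫ₛᵗ ∫ f⟫ = ∫ₛᵗ ∫ ⟪a, f⟫`. [folklore] -/
private theorem IsClassicalNSSolutionOn.inner_intervalIntegral_integral_force
    (h : IsClassicalNSSolutionOn (Icc 0 T) ν f u p) (hT : 0 < T)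
    {F : EuclideanSpace ℝ (Fin 3) → ℝ} (hF : Integrable F) (hfF : ∀ τ ∈ Icc 0 T, ∀ x, ‖f τ x‖ ≤ F x)
    {s t : ℝ} (hs : 0 ≤ s) (hst : s ≤ t) (ht : t ≤ T) (b : EuclideanSpace ℝ (Fin 3)) :
    ⟪b, ∫ τ in s..t, ∫ x, f τ x⟫ = ∫ τ in s..t, ∫ x, ⟪b, f τ x⟫ := by
  have hfc : ContinuousOn (uncurry f) (Icc 0 T ×ˢ univ) :=
    (h.isSmoothSpaceTimeOn_force (uniqueDiffOn_Icc hT)).continuousOn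
  have hfc' : ContinuousOn (uncurry f) (Icc s t ×ˢ univ) :=
    hfc.mono (prod_mono (Icc_subset_Icc hs ht) Subset.rfl)
  have hfprod := integrable_prod_of_dominated' hfc' hF fun τ hτ x => hfF τ ⟨hs.trans hτ.1, hτ.2.trans ht⟩ x
  have hmean : IntervalIntegrable (fun τ => ∫ x, f τ x) volume s t := by
    rw [intervalIntegrable_iff_integrableOn_Ioo_of_le hst]
    exact hfprod.integral_prod_left
  have e := (innerSL ℝ b).intervalIntegral_comp_comm hmean
  simp only [innerSL_apply_apply] at e
  rw [← e]
  refine intervalIntegral.integral_congr fun τ hτ => ?_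
  rw [uIcc_of_le hst] at hτ
  have hτT : τ ∈ Icc 0 T := ⟨hs.trans hτ.1, hτ.2.trans ht⟩
  have hfi : Integrable (f τ) := hF.mono' (continuous_slice_of_continuousOn hfc hτT).aestronglyMeasurable
    (Eventually.of_forall (hfF τ hτT))
  exact (integral_inner hfi b).symm

/-- **THE FULL IMPULSE BALANCE FROM THE ENERGY (Saffman (3.2.9), vector form).** Let `(u, p)` be a classical
solution of the Navier–Stokes system (any viscosity `ν`) with force `f` on `[0, T] × ℝ³`, `0 < T`, with a uniform
energy level `∫ ‖u(τ)‖² ≤ E` and an integrable majorant of the force slices. If the impulse densities `x × ω(s)`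
and `x × ω(t)` (`0 ≤ s ≤ t ≤ T`) are integrable, then
`∫ x × ω(t, x) dx − ∫ x × ω(s, x) dx = 2 ∫ₛᵗ ∫ f(τ, x) dx dτ`:
the hydrodynamic impulse `I = ½ ∫ x × ω` changes exactly by the total push — conserved without force, untouched by
viscosity and transport — with NO hypothesis on the vorticity in between. [cite: Saffman1992, §3.2 eqs. (3.2.8), (3.2.9)] -/
theorem IsClassicalNSSolutionOn.integral_cross_vorticity_sub_eq_of_energy
    (h : IsClassicalNSSolutionOn (Icc 0 T) ν f u p) (hT : 0 < T) {E : ℝ}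
    (h2 : ∀ τ ∈ Icc 0 T, Integrable fun x => ‖u τ x‖ ^ 2) (hE : ∀ τ ∈ Icc 0 T, ∫ x, ‖u τ x‖ ^ 2 ≤ E)
    {F : EuclideanSpace ℝ (Fin 3) → ℝ} (hF : Integrable F) (hfF : ∀ τ ∈ Icc 0 T, ∀ x, ‖f τ x‖ ≤ F x)
    {s t : ℝ} (hs : 0 ≤ s) (hst : s ≤ t) (ht : t ≤ T)
    (hIs : Integrable fun x => cross x (curl (u s) x)) (hIt : Integrable fun x => cross x (curl (u t) x)) :
    (∫ x, cross x (curl (u t) x)) - ∫ x, cross x (curl (u s) x) = (2 : ℝ) • ∫ τ in s..t, ∫ x, f τ x := by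
  refine ext_inner_left ℝ fun b => ?_
  rw [inner_sub_right, ← integral_inner hIt b, ← integral_inner hIs b, real_inner_smul_right,
    h.inner_intervalIntegral_integral_force hT hF hfF hs hst ht b]
  exact h.integral_inner_cross_vorticity_sub_eq_of_energy b hT h2 hE hF hfF hs hst ht (hIs.const_inner b)
    (hIt.const_inner b)

end Dynamics

end Literature.Analysis.FluidPDE

end
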